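import Mathlib.Analysis.Distribution.SchwartzSpace.Basic
import Mathlib.Analysis.SpecialFunctions.Log.Deriv
import Mathlib.Analysis.Calculus.IteratedDeriv.Lemmas
import HarnessLib

/-!
# `u ↦ F(log u)/u` is a Schwartz function for super-exponentially decaying `F`

Analysis/Distribution support file (everything proved). In the Osterwalder–Schrader continuation
(Comm. Math. Phys. 42 (1975), Ch. V–VI) the profiles of the gap variables `u > 0` are Gaussian
windowed functions of `s = log u`, i.e. weights `u ↦ F(log u)/u` on `(0, ∞)` with
`F(s) = e^{-bs²} ϑ(s)`; the regularisation estimates of Ch. VI.1 need these weights to be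
**Schwartz functions of `u`** (extended by zero to `u ≤ 0`). This file proves it for every smooth
`F` all of whose derivatives decay faster than every exponential:

* `logPullback F n` — the functions `Φₙ = Lₙ F`, `Φ₀ = F`, `Φₙ₊₁ = Φₙ' - (n+1) Φₙ`;
* `iteratedDeriv_logWeightFun` — on `(0, ∞)`, `Dⁿ[F(log u)/u] = Φₙ(log u) / u^{n+1}`;
* `contDiff_logWeightFun`, `decay_logWeightFun` — the extension by zero is `C^∞` on `ℝ` with
  the same formula (`0` for `u ≤ 0`) and has Schwartz decay;
* `logWeightSchwartz F` — the resulting element of `𝓢(ℝ, ℂ)`, with `logWeightSchwartz_apply`.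

## References

* K. Osterwalder, R. Schrader, *Axioms for Euclidean Green's functions II*, Comm. Math. Phys.
  42 (1975) 281–305, Ch. VI.1. [OsterwalderSchraderCMP1975]
-/

noncomputable section

open Set Filter
open scoped Topology

namespace Literature.Analysis.Distribution

/-! ### The differential recursion `Φₙ₊₁ = Φₙ' - (n+1) Φₙ` -/

/-- The **log-pullback derivatives** `Φₙ`: `Φ₀ = F`, `Φₙ₊₁ = Φₙ' - (n+1) Φₙ`. [folklore] -/
def logPullback (F : ℝ → ℂ) : ℕ → ℝ → ℂ
  | 0 => F
  | n + 1 => fun s => deriv (logPullback F n) s - ((n : ℂ) + 1) * logPullback F n s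

/-- `Φ₀ = F`. [folklore] -/
@[simp] theorem logPullback_zero (F : ℝ → ℂ) : logPullback F 0 = F := rfl

/-- The recursion. [folklore] -/
theorem logPullback_succ (F : ℝ → ℂ) (n : ℕ) (s : ℝ) :
    logPullback F (n + 1) s = deriv (logPullback F n) s - ((n : ℂ) + 1) * logPullback F n s := rfl

/-- All `Φₙ` are smooth if `F` is. [folklore] -/
theorem contDiff_logPullback {F : ℝ → ℂ} (hF : ContDiff ℝ (⊤ : ℕ∞) F) (n : ℕ) :
    ContDiff ℝ (⊤ : ℕ∞) (logPullback F n) := by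
  induction n with
  | zero => exact hF
  | succ n ih =>
      have h1 : ContDiff ℝ (⊤ : ℕ∞) (deriv (logPullback F n)) := by
        have := ih.iterate_deriv 1
        simpa using this
      exact h1.sub (contDiff_const.mul ih)

/-! ### The weight on `(0, ∞)` and its iterated derivatives -/

/-- The **log-weight function** `u ↦ F(log u)/u` for `u > 0`, `0` for `u ≤ 0`. [folklore] -/
def logWeightFun (F : ℝ → ℂ) (u : ℝ) : ℂ := if 0 < u then F (Real.log u) / (u : ℂ) else 0

/-- The candidate `n`-th derivative: `Φₙ(log u)/u^{n+1}` for `u > 0`, `0` for `u ≤ 0`. [folklore] -/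
def logWeightDer (F : ℝ → ℂ) (n : ℕ) (u : ℝ) : ℂ :=
  if 0 < u then logPullback F n (Real.log u) / (u : ℂ) ^ (n + 1) else 0

/-- `logWeightDer F 0 = logWeightFun F`. [folklore] -/
theorem logWeightDer_zero (F : ℝ → ℂ) : logWeightDer F 0 = logWeightFun F := by
  funext u; simp [logWeightDer, logWeightFun]

/-- **The derivative on `(0, ∞)`**: `d/du [Φₙ(log u)/u^{n+1}] = Φₙ₊₁(log u)/u^{n+2}`. [folklore] -/
theorem hasDerivAt_logWeightDer_of_pos {F : ℝ → ℂ} (hF : ContDiff ℝ (⊤ : ℕ∞) F) (n : ℕ) {u : ℝ} (hu : 0 < u) :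
    HasDerivAt (logWeightDer F n) (logWeightDer F (n + 1) u) u := by
  -- on a neighbourhood of `u` the function is `Φₙ(log u)/u^{n+1}`
  have hev : logWeightDer F n =ᶠ[𝓝 u] fun v => logPullback F n (Real.log v) / (v : ℂ) ^ (n + 1) := by
    filter_upwards [Ioi_mem_nhds hu] with v hv
    rw [logWeightDer, if_pos (show 0 < v from hv)]
  rw [hev.hasDerivAt_iff, logWeightDer, if_pos hu, logPullback_succ]
  have hu0 : (u : ℂ) ≠ 0 := Complex.ofReal_ne_zero.2 hu.ne'
  -- the numerator
  have hΦ : HasDerivAt (fun v => logPullback F n (Real.log v))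
      ((u⁻¹ : ℝ) • deriv (logPullback F n) (Real.log u)) u := by
    have hd : HasDerivAt (logPullback F n) (deriv (logPullback F n) (Real.log u)) (Real.log u) :=
      ((contDiff_logPullback hF n).differentiable (by simp)).differentiableAt.hasDerivAt
    exact hd.scomp u (Real.hasDerivAt_log hu.ne')
  -- the denominator
  have hc : HasDerivAt (fun v : ℝ => (v : ℂ)) 1 u := Complex.ofRealCLM.hasDerivAt
  have hpow : HasDerivAt (fun v : ℝ => (v : ℂ) ^ (n + 1)) (((n + 1 : ℕ) : ℂ) * (u : ℂ) ^ (n + 1 - 1) * 1) u :=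
    hc.pow (n + 1)
  have hne : ((u : ℂ)) ^ (n + 1) ≠ 0 := pow_ne_zero _ hu0
  refine (hΦ.div hpow hne).congr_deriv ?_
  rw [Nat.add_sub_cancel, Complex.real_smul, Complex.ofReal_inv]
  push_cast
  field_simp
  ring

/-- On `(-∞, 0)` the candidate derivatives vanish identically, hence differentiate to `0`. [folklore] -/
theorem hasDerivAt_logWeightDer_of_neg (F : ℝ → ℂ) (n : ℕ) {u : ℝ} (hu : u < 0) :
    HasDerivAt (logWeightDer F n) (logWeightDer F (n + 1) u) u := by
  have hev : logWeightDer F n =ᶠ[𝓝 u] fun _ => (0 : ℂ) := by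
    filter_upwards [Iio_mem_nhds hu] with v hv
    rw [logWeightDer, if_neg (not_lt.2 (le_of_lt hv))]
  rw [hev.hasDerivAt_iff, logWeightDer, if_neg (not_lt.2 hu.le)]
  exact hasDerivAt_const _ _

/-! ### Behaviour at `u = 0` under super-exponential decay -/

/-- **Super-exponential decay of all derivatives**: `‖F⁽ʲ⁾(s)‖ ≤ C e^{cs}` for every `j` and every
real `c` (both signs: decay faster than any exponential at `±∞`). [folklore] -/
def SuperExpDecay (F : ℝ → ℂ) : Prop :=
  ∀ (j : ℕ) (c : ℝ), ∃ C : ℝ, ∀ s, ‖iteratedDeriv j F s‖ ≤ C * Real.exp (c * s)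

/-- Super-exponential decay passes to the log-pullbacks `Φₙ` (and all their derivatives). [folklore] -/
theorem superExpDecay_logPullback {F : ℝ → ℂ} (hF : ContDiff ℝ (⊤ : ℕ∞) F) (hdec : SuperExpDecay F) (n : ℕ) :
    SuperExpDecay (logPullback F n) := by
  induction n with
  | zero => exact hdec
  | succ n ih =>
      intro j c
      obtain ⟨C₁, hC₁⟩ := ih (j + 1) c
      obtain ⟨C₂, hC₂⟩ := ih j c
      refine ⟨C₁ + ((n : ℝ) + 1) * |C₂|, fun s => ?_⟩
      have hsmooth : ContDiff ℝ (⊤ : ℕ∞) (logPullback F n) := contDiff_logPullback hF n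
      have hfun : logPullback F (n + 1) = deriv (logPullback F n) - fun s => ((n : ℂ) + 1) * logPullback F n s := by
        funext s; rfl
      have hd : ContDiffAt ℝ j (deriv (logPullback F n)) s := by
        have := hsmooth.iterate_deriv 1
        simp only [Function.iterate_one] at this
        exact (this.of_le (by exact_mod_cast le_top)).contDiffAt
      have hm : ContDiffAt ℝ j (fun s => ((n : ℂ) + 1) * logPullback F n s) s :=
        (contDiffAt_const.mul (hsmooth.of_le (by exact_mod_cast le_top)).contDiffAt)
      rw [hfun, iteratedDeriv_sub hd hm, ← iteratedDeriv_succ',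
        iteratedDeriv_const_mul _ ((hsmooth.of_le (by exact_mod_cast le_top)).contDiffAt)]
      refine (norm_sub_le _ _).trans ?_
      rw [norm_mul, add_mul]
      refine add_le_add (hC₁ s) ?_
      have hn : ‖((n : ℂ) + 1)‖ = (n : ℝ) + 1 := by
        rw [show ((n : ℂ) + 1) = ((n + 1 : ℕ) : ℂ) by push_cast; ring, Complex.norm_natCast]; push_cast; ring
      rw [hn, mul_assoc]
      refine mul_le_mul_of_nonneg_left ((hC₂ s).trans ?_) (by positivity)
      exact mul_le_mul_of_nonneg_right (le_abs_self _) (Real.exp_pos _).le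

/-- The candidate derivatives are `O(u²)` at `0⁺`: `‖logWeightDer F n u‖ ≤ C u²` for `u > 0`
(take `c = n + 3` in the decay of `Φₙ`). [folklore] -/
theorem norm_logWeightDer_le_sq {F : ℝ → ℂ} (hF : ContDiff ℝ (⊤ : ℕ∞) F) (hdec : SuperExpDecay F) (n : ℕ) :
    ∃ C : ℝ, 0 ≤ C ∧ ∀ u, ‖logWeightDer F n u‖ ≤ C * u ^ 2 := by
  obtain ⟨C, hC⟩ := superExpDecay_logPullback hF hdec n 0 ((n : ℝ) + 3)
  have hC0 : 0 ≤ C := by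
    have h := hC 0
    simp only [iteratedDeriv_zero, mul_zero, Real.exp_zero, mul_one] at h
    exact (norm_nonneg _).trans h
  refine ⟨C, hC0, fun u => ?_⟩
  rcases le_or_gt u 0 with hu | hu
  · rw [logWeightDer, if_neg (not_lt.2 hu), norm_zero]; positivity
  · rw [logWeightDer, if_pos hu, norm_div, norm_pow, Complex.norm_real, Real.norm_eq_abs, abs_of_pos hu]
    have h := hC (Real.log u)
    rw [iteratedDeriv_zero] at h
    have hexp : Real.exp (((n : ℝ) + 3) * Real.log u) = u ^ (n + 3) := by
      rw [← Real.log_rpow hu, Real.exp_log (Real.rpow_pos_of_pos hu _)]; norm_cast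
    rw [hexp] at h
    rw [div_le_iff₀ (pow_pos hu _)]
    calc ‖logPullback F n (Real.log u)‖ ≤ C * u ^ (n + 3) := h
      _ = C * u ^ 2 * u ^ (n + 1) := by ring

/-- **The derivative at `0` vanishes.** [folklore] -/
theorem hasDerivAt_logWeightDer_zero {F : ℝ → ℂ} (hF : ContDiff ℝ (⊤ : ℕ∞) F) (hdec : SuperExpDecay F) (n : ℕ) :
    HasDerivAt (logWeightDer F n) (logWeightDer F (n + 1) 0) 0 := by
  have h0 : logWeightDer F (n + 1) 0 = 0 := by rw [logWeightDer, if_neg (lt_irrefl _)]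
  have h00 : logWeightDer F n 0 = 0 := by rw [logWeightDer, if_neg (lt_irrefl _)]
  rw [h0, hasDerivAt_iff_isLittleO_nhds_zero]
  simp only [zero_add, h00, sub_zero, smul_zero]
  obtain ⟨C, hC0, hC⟩ := norm_logWeightDer_le_sq hF hdec n
  refine Asymptotics.IsBigO.trans_isLittleO (g := fun h : ℝ => h ^ 2) ?_ ?_
  · exact Asymptotics.IsBigO.of_bound C (Eventually.of_forall fun h => by
      rw [Real.norm_eq_abs, abs_of_nonneg (sq_nonneg _)]; exact hC h)
  · simpa using Asymptotics.isLittleO_pow_id (one_lt_two)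

/-- **All candidate derivatives differentiate to the next one, everywhere.** [folklore] -/
theorem hasDerivAt_logWeightDer {F : ℝ → ℂ} (hF : ContDiff ℝ (⊤ : ℕ∞) F) (hdec : SuperExpDecay F) (n : ℕ) (u : ℝ) :
    HasDerivAt (logWeightDer F n) (logWeightDer F (n + 1) u) u := by
  rcases lt_trichotomy u 0 with hu | rfl | hu
  · exact hasDerivAt_logWeightDer_of_neg F n hu
  · exact hasDerivAt_logWeightDer_zero hF hdec n
  · exact hasDerivAt_logWeightDer_of_pos hF n hu

/-- `deriv (logWeightDer F n) = logWeightDer F (n+1)`. [folklore] -/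
theorem deriv_logWeightDer {F : ℝ → ℂ} (hF : ContDiff ℝ (⊤ : ℕ∞) F) (hdec : SuperExpDecay F) (n : ℕ) :
    deriv (logWeightDer F n) = logWeightDer F (n + 1) :=
  funext fun u => (hasDerivAt_logWeightDer hF hdec n u).deriv

/-- **The iterated derivatives of the log-weight function**: `Dⁿ(logWeightFun F) = logWeightDer F n`. [folklore] -/
theorem iteratedDeriv_logWeightFun {F : ℝ → ℂ} (hF : ContDiff ℝ (⊤ : ℕ∞) F) (hdec : SuperExpDecay F) (n : ℕ) :
    iteratedDeriv n (logWeightFun F) = logWeightDer F n := by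
  induction n with
  | zero => rw [iteratedDeriv_zero, logWeightDer_zero]
  | succ n ih => rw [iteratedDeriv_succ, ih, deriv_logWeightDer hF hdec n]

/-- **The log-weight function is smooth on `ℝ`.** [folklore] -/
theorem contDiff_logWeightFun {F : ℝ → ℂ} (hF : ContDiff ℝ (⊤ : ℕ∞) F) (hdec : SuperExpDecay F) :
    ContDiff ℝ (⊤ : ℕ∞) (logWeightFun F) := by
  refine contDiff_of_differentiable_iteratedDeriv fun m _ => ?_
  rw [iteratedDeriv_logWeightFun hF hdec m]
  exact fun u => (hasDerivAt_logWeightDer hF hdec m u).differentiableAt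

/-- **Schwartz decay of the log-weight function**: `|u|ᵏ ‖Dⁿ(logWeightFun F)(u)‖ ≤ C` (take
`c = n + 1 - k` in the decay of `Φₙ`). [folklore] -/
theorem decay_logWeightFun {F : ℝ → ℂ} (hF : ContDiff ℝ (⊤ : ℕ∞) F) (hdec : SuperExpDecay F) (k n : ℕ) :
    ∃ C : ℝ, ∀ u, |u| ^ k * ‖iteratedDeriv n (logWeightFun F) u‖ ≤ C := by
  obtain ⟨C, hC⟩ := superExpDecay_logPullback hF hdec n 0 ((n : ℝ) + 1 - k)
  have hC0 : 0 ≤ C := by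
    have h := hC 0
    simp only [iteratedDeriv_zero, mul_zero, Real.exp_zero, mul_one] at h
    exact (norm_nonneg _).trans h
  refine ⟨C, fun u => ?_⟩
  rw [iteratedDeriv_logWeightFun hF hdec n]
  rcases le_or_gt u 0 with hu | hu
  · rw [logWeightDer, if_neg (not_lt.2 hu), norm_zero, mul_zero]; exact hC0
  · rw [logWeightDer, if_pos hu, norm_div, norm_pow, Complex.norm_real, Real.norm_eq_abs, abs_of_pos hu]
    have h := hC (Real.log u)
    rw [iteratedDeriv_zero] at h
    have hexp : Real.exp (((n : ℝ) + 1 - k) * Real.log u) = u ^ (n + 1) / u ^ k := by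
      rw [sub_mul, Real.exp_sub, ← Real.log_rpow hu, Real.exp_log (Real.rpow_pos_of_pos hu _),
        ← Real.log_rpow hu, Real.exp_log (Real.rpow_pos_of_pos hu _)]
      norm_cast
    rw [hexp] at h
    have hupos : 0 < u ^ (n + 1) := pow_pos hu _
    have hukpos : 0 < u ^ k := pow_pos hu _
    rw [mul_div_assoc']
    rw [div_le_iff₀ hupos]
    calc u ^ k * ‖logPullback F n (Real.log u)‖ ≤ u ^ k * (C * (u ^ (n + 1) / u ^ k)) :=
          mul_le_mul_of_nonneg_left h hukpos.le
      _ = C * u ^ (n + 1) := by field_simp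

/-- **The log-weight function as a Schwartz function** `u ↦ F(log u)/u` (`0` for `u ≤ 0`). [cite: OsterwalderSchraderCMP1975, Ch. VI.1] -/
def logWeightSchwartz (F : ℝ → ℂ) (hF : ContDiff ℝ (⊤ : ℕ∞) F) (hdec : SuperExpDecay F) : SchwartzMap ℝ ℂ where
  toFun := logWeightFun F
  smooth' := (contDiff_logWeightFun hF hdec).of_le (by exact_mod_cast le_top)
  decay' k n := by
    obtain ⟨C, hC⟩ := decay_logWeightFun hF hdec k n
    exact ⟨C, fun u => by rw [norm_iteratedFDeriv_eq_norm_iteratedDeriv, Real.norm_eq_abs]; exact hC u⟩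

/-- Values of the log-weight Schwartz function. [folklore] -/
@[simp] theorem logWeightSchwartz_apply (F : ℝ → ℂ) (hF : ContDiff ℝ (⊤ : ℕ∞) F) (hdec : SuperExpDecay F) (u : ℝ) :
    logWeightSchwartz F hF hdec u = logWeightFun F u := rfl

/-- Seminorms of the log-weight Schwartz function through the decay constants. [folklore] -/
theorem seminorm_logWeightSchwartz_le (F : ℝ → ℂ) (hF : ContDiff ℝ (⊤ : ℕ∞) F) (hdec : SuperExpDecay F) (k n : ℕ)
    {C : ℝ} (hC0 : 0 ≤ C) (hC : ∀ u, |u| ^ k * ‖iteratedDeriv n (logWeightFun F) u‖ ≤ C) :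
    SchwartzMap.seminorm ℝ k n (logWeightSchwartz F hF hdec) ≤ C :=
  SchwartzMap.seminorm_le_bound ℝ k n _ hC0 fun u => by
    rw [norm_iteratedFDeriv_eq_norm_iteratedDeriv, Real.norm_eq_abs]; exact hC u

/-! ### Gaussian-windowed functions with temperate derivatives decay super-exponentially -/

/-- Orders `k : ℕ` are below `⊤` in `WithTop ℕ∞`. [folklore] -/
theorem natCast_le_top' (k : ℕ) : ((k : ℕ∞) : WithTop ℕ∞) ≤ ((⊤ : ℕ∞) : WithTop ℕ∞) :=
  WithTop.coe_le_coe.2 le_top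

/-- The derivative of `s ↦ s H(s)`. [folklore] -/
theorem deriv_id_mul {H : ℝ → ℂ} (hH : ContDiff ℝ (⊤ : ℕ∞) H) (s : ℝ) :
    deriv (fun s : ℝ => (s : ℂ) * H s) s = H s + (s : ℂ) * deriv H s := by
  have hd : HasDerivAt H (deriv H s) s := (hH.differentiable (by simp)).differentiableAt.hasDerivAt
  have h : HasDerivAt (fun s : ℝ => (s : ℂ) * H s) (1 * H s + (s : ℂ) * deriv H s) s :=
    (Complex.ofRealCLM.hasDerivAt (x := s)).mul hd
  rw [h.deriv, one_mul]

/-- `s ↦ s H(s)` is smooth. [folklore] -/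
theorem contDiff_id_mul {H : ℝ → ℂ} (hH : ContDiff ℝ (⊤ : ℕ∞) H) : ContDiff ℝ (⊤ : ℕ∞) fun s : ℝ => (s : ℂ) * H s :=
  Complex.ofRealCLM.contDiff.mul hH

/-- The derivative of a smooth function is smooth. [folklore] -/
theorem contDiff_deriv_of_top {H : ℝ → ℂ} (hH : ContDiff ℝ (⊤ : ℕ∞) H) : ContDiff ℝ (⊤ : ℕ∞) (deriv H) := by
  have := hH.iterate_deriv 1; simpa using this

/-- `Dᵐ⁺¹(s H(s)) = s Dᵐ⁺¹ H(s) + (m+1) Dᵐ H(s)` for smooth `H`. [folklore] -/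
theorem iteratedDeriv_id_mul {H : ℝ → ℂ} (hH : ContDiff ℝ (⊤ : ℕ∞) H) (m : ℕ) :
    iteratedDeriv (m + 1) (fun s : ℝ => (s : ℂ) * H s) =
      fun s : ℝ => (s : ℂ) * iteratedDeriv (m + 1) H s + ((m : ℂ) + 1) * iteratedDeriv m H s := by
  induction m generalizing H with
  | zero =>
      funext s
      rw [zero_add, iteratedDeriv_one, iteratedDeriv_one, iteratedDeriv_zero, deriv_id_mul hH]
      push_cast; ring
  | succ m ih =>
      funext s
      have hH' := contDiff_deriv_of_top hH
      have hderiv : deriv (fun s : ℝ => (s : ℂ) * H s) = H + fun s : ℝ => (s : ℂ) * deriv H s := by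
        funext s; rw [deriv_id_mul hH]; rfl
      rw [iteratedDeriv_succ', hderiv,
        iteratedDeriv_add ((hH.of_le (natCast_le_top' _)).contDiffAt)
          (((contDiff_id_mul hH').of_le (natCast_le_top' _)).contDiffAt),
        ih hH', ← iteratedDeriv_succ', ← iteratedDeriv_succ']
      push_cast
      ring

/-- The **Gaussian recursion**: `G₀ = G`, `Gᵢ₊₁ = Gᵢ' - 2b s Gᵢ`. [folklore] -/
def gaussSeq (b : ℝ) (G : ℝ → ℂ) : ℕ → ℝ → ℂ
  | 0 => G
  | i + 1 => fun s : ℝ => deriv (gaussSeq b G i) s - 2 * (b : ℂ) * (s : ℂ) * gaussSeq b G i s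

/-- All `Gᵢ` are smooth. [folklore] -/
theorem contDiff_gaussSeq (b : ℝ) {G : ℝ → ℂ} (hG : ContDiff ℝ (⊤ : ℕ∞) G) (i : ℕ) :
    ContDiff ℝ (⊤ : ℕ∞) (gaussSeq b G i) := by
  induction i with
  | zero => exact hG
  | succ i ih =>
      exact (contDiff_deriv_of_top ih).sub ((contDiff_const.mul Complex.ofRealCLM.contDiff).mul ih)

/-- **Derivatives of a Gaussian-windowed function**: `Dʲ(e^{-bs²} G) = e^{-bs²} Gⱼ`. [folklore] -/
theorem iteratedDeriv_gaussian_mul (b : ℝ) {G : ℝ → ℂ} (hG : ContDiff ℝ (⊤ : ℕ∞) G) (j : ℕ) :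
    iteratedDeriv j (fun s : ℝ => Complex.exp (-(b : ℂ) * (s : ℂ) ^ 2) * G s) =
      fun s : ℝ => Complex.exp (-(b : ℂ) * (s : ℂ) ^ 2) * gaussSeq b G j s := by
  induction j with
  | zero => rfl
  | succ j ih =>
      rw [iteratedDeriv_succ, ih]
      funext s
      have hg : HasDerivAt (fun s : ℝ => Complex.exp (-(b : ℂ) * (s : ℂ) ^ 2))
          (Complex.exp (-(b : ℂ) * (s : ℂ) ^ 2) * (-(b : ℂ) * (2 * (s : ℂ)))) s := by
        have h1 : HasDerivAt (fun s : ℝ => -(b : ℂ) * (s : ℂ) ^ 2) (-(b : ℂ) * (2 * (s : ℂ) ^ 1 * 1)) s :=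
          ((Complex.ofRealCLM.hasDerivAt (x := s)).pow 2).const_mul _
        have h2 := h1.cexp
        simp only [pow_one, mul_one] at h2
        exact h2
      have hd : HasDerivAt (gaussSeq b G j) (deriv (gaussSeq b G j) s) s :=
        ((contDiff_gaussSeq b hG j).differentiable (by simp)).differentiableAt.hasDerivAt
      have h : HasDerivAt (fun s : ℝ => Complex.exp (-(b : ℂ) * (s : ℂ) ^ 2) * gaussSeq b G j s)
          (Complex.exp (-(b : ℂ) * (s : ℂ) ^ 2) * (-(b : ℂ) * (2 * (s : ℂ))) * gaussSeq b G j s +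
            Complex.exp (-(b : ℂ) * (s : ℂ) ^ 2) * deriv (gaussSeq b G j) s) s := hg.mul hd
      rw [h.deriv]
      simp only [gaussSeq]
      ring

/-- **Temperate bounds along the Gaussian recursion**: if `‖DᵐG(s)‖ ≤ A (1+|s|)ᴺ` for `m ≤ j`,
then `‖Dᵐ Gᵢ(s)‖ ≤ A (1 + 2|b|(1+j))ⁱ (1+|s|)^{N+i}` for `m + i ≤ j`. [folklore] -/
theorem norm_iteratedDeriv_gaussSeq_le (b : ℝ) {G : ℝ → ℂ} (hG : ContDiff ℝ (⊤ : ℕ∞) G) (j : ℕ) {A : ℝ} {N : ℕ}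
    (hA : ∀ m ≤ j, ∀ s, ‖iteratedDeriv m G s‖ ≤ A * (1 + |s|) ^ N) (i : ℕ) :
    ∀ m, m + i ≤ j → ∀ s, ‖iteratedDeriv m (gaussSeq b G i) s‖ ≤
      A * (1 + 2 * |b| * (1 + j)) ^ i * (1 + |s|) ^ (N + i) := by
  induction i with
  | zero =>
      intro m hm s
      simpa [gaussSeq] using hA m (by omega) s
  | succ i ih =>
      intro m hm s
      have hA0 : 0 ≤ A := by
        have h := hA 0 (Nat.zero_le _) 0
        simp only [iteratedDeriv_zero, abs_zero, add_zero, one_pow, mul_one] at h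
        exact (norm_nonneg _).trans h
      have hsm : ContDiff ℝ (⊤ : ℕ∞) (gaussSeq b G i) := contDiff_gaussSeq b hG i
      have hsm' : ContDiff ℝ (⊤ : ℕ∞) (deriv (gaussSeq b G i)) := by
        have := hsm.iterate_deriv 1; simpa using this
      -- `Dᵐ G_{i+1} = D^{m+1} G_i - 2b Dᵐ(s G_i)`
      have hfun : gaussSeq b G (i + 1) = deriv (gaussSeq b G i) - fun s : ℝ => 2 * (b : ℂ) * ((s : ℂ) * gaussSeq b G i s) := by
        funext s; simp only [gaussSeq, Pi.sub_apply]; ring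
      have hc1 : ContDiffAt ℝ m (deriv (gaussSeq b G i)) s := (hsm'.of_le (by exact_mod_cast le_top)).contDiffAt
      have hprod : ContDiff ℝ (⊤ : ℕ∞) (fun s : ℝ => (s : ℂ) * gaussSeq b G i s) := Complex.ofRealCLM.contDiff.mul hsm
      have hc2 : ContDiffAt ℝ m (fun s : ℝ => 2 * (b : ℂ) * ((s : ℂ) * gaussSeq b G i s)) s :=
        ((contDiff_const.mul hprod).of_le (by exact_mod_cast le_top)).contDiffAt
      rw [hfun, iteratedDeriv_sub hc1 hc2, ← iteratedDeriv_succ',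
        iteratedDeriv_const_mul _ ((hprod.of_le (by exact_mod_cast le_top)).contDiffAt)]
      have hK : (1 : ℝ) ≤ 1 + 2 * |b| * (1 + j) := by nlinarith [abs_nonneg b, (by positivity : (0 : ℝ) ≤ j)]
      have hs1 : (1 : ℝ) ≤ 1 + |s| := by linarith [abs_nonneg s]
      set K : ℝ := A * (1 + 2 * |b| * (1 + j)) ^ i with hKdef
      have hK0 : 0 ≤ K := by positivity
      have h1 : ‖iteratedDeriv (m + 1) (gaussSeq b G i) s‖ ≤ K * (1 + |s|) ^ (N + i) := ih (m + 1) (by omega) s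
      -- the product term: `‖Dᵐ(s Gᵢ)‖ ≤ (1+|s|)(1+m) K (1+|s|)^{N+i}`
      have h2 : ‖iteratedDeriv m (fun s : ℝ => (s : ℂ) * gaussSeq b G i s) s‖ ≤
          (1 + |s|) * (1 + m) * (K * (1 + |s|) ^ (N + i)) := by
        have hKX : 0 ≤ K * (1 + |s|) ^ (N + i) := by positivity
        rcases m with _ | m
        · rw [iteratedDeriv_zero, norm_mul, Complex.norm_real, Real.norm_eq_abs]
          have h0 := ih 0 (by omega) s
          rw [iteratedDeriv_zero] at h0
          have : |s| * ‖gaussSeq b G i s‖ ≤ (1 + |s|) * (K * (1 + |s|) ^ (N + i)) :=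
            mul_le_mul (by linarith [abs_nonneg s]) h0 (norm_nonneg _) (by positivity)
          simpa using this
        · rw [iteratedDeriv_id_mul hsm m]
          have ha := ih (m + 1) (by omega) s
          have hb' := ih m (by omega) s
          refine (norm_add_le _ _).trans ?_
          rw [norm_mul, norm_mul, Complex.norm_real, Real.norm_eq_abs]
          have hm1 : ‖((m : ℂ) + 1)‖ = (m : ℝ) + 1 := by
            rw [show ((m : ℂ) + 1) = ((m + 1 : ℕ) : ℂ) by push_cast; ring, Complex.norm_natCast]; push_cast; ring
          rw [hm1]
          have e1 : |s| * ‖iteratedDeriv (m + 1) (gaussSeq b G i) s‖ ≤ |s| * (K * (1 + |s|) ^ (N + i)) :=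
            mul_le_mul_of_nonneg_left ha (abs_nonneg s)
          have e2 : ((m : ℝ) + 1) * ‖iteratedDeriv m (gaussSeq b G i) s‖ ≤ ((m : ℝ) + 1) * (K * (1 + |s|) ^ (N + i)) :=
            mul_le_mul_of_nonneg_left hb' (by positivity)
          have e3 : |s| * (K * (1 + |s|) ^ (N + i)) + ((m : ℝ) + 1) * (K * (1 + |s|) ^ (N + i)) ≤
              (1 + |s|) * (1 + ((m + 1 : ℕ) : ℝ)) * (K * (1 + |s|) ^ (N + i)) := by
            have key : 0 ≤ (K * (1 + |s|) ^ (N + i)) * (|s| * ((m : ℝ) + 1) + 1) := mul_nonneg hKX (by positivity)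
            push_cast
            nlinarith [key, abs_nonneg s, hKX]
          push_cast at e3 ⊢
          linarith
      refine (norm_sub_le _ _).trans ?_
      rw [norm_mul, show ‖(2 * (b : ℂ))‖ = 2 * |b| by simp]
      have hmj : (1 : ℝ) + m ≤ 1 + j := by
        have : (m : ℝ) ≤ j := by exact_mod_cast (show m ≤ j by omega)
        linarith
      have hKX : 0 ≤ K * (1 + |s|) ^ (N + i) := by positivity
      have step1 : K * (1 + |s|) ^ (N + i) ≤ K * (1 + |s|) ^ (N + i) * (1 + |s|) := le_mul_of_one_le_right hKX hs1
      have step2 : 2 * |b| * ((1 + |s|) * (1 + m) * (K * (1 + |s|) ^ (N + i))) ≤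
          2 * |b| * ((1 + |s|) * (1 + j) * (K * (1 + |s|) ^ (N + i))) := by gcongr
      calc ‖iteratedDeriv (m + 1) (gaussSeq b G i) s‖ + 2 * |b| * ‖iteratedDeriv m (fun s : ℝ => (s : ℂ) * gaussSeq b G i s) s‖
          ≤ K * (1 + |s|) ^ (N + i) + 2 * |b| * ((1 + |s|) * (1 + m) * (K * (1 + |s|) ^ (N + i))) := by gcongr
        _ ≤ K * (1 + |s|) ^ (N + i) * (1 + |s|) + 2 * |b| * ((1 + |s|) * (1 + j) * (K * (1 + |s|) ^ (N + i))) :=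
            add_le_add step1 step2
        _ = K * (1 + 2 * |b| * (1 + j)) * (1 + |s|) ^ (N + i + 1) := by ring
        _ = A * (1 + 2 * |b| * (1 + j)) ^ (i + 1) * (1 + |s|) ^ (N + (i + 1)) := by
            rw [hKdef, pow_succ, show N + (i + 1) = N + i + 1 by ring]; ring

/-- Completing the square: `e^{-bs²} e^{M|s|} e^{-cs} ≤ e^{(M+|c|)²/(4b)}` (`b > 0`). [folklore] -/
theorem exp_gauss_bound {b : ℝ} (hb : 0 < b) (M c s : ℝ) :
    Real.exp (-b * s ^ 2) * Real.exp (M * |s|) ≤ Real.exp ((M + |c|) ^ 2 / (4 * b)) * Real.exp (c * s) := by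
  rw [← Real.exp_add, ← Real.exp_add]
  refine Real.exp_le_exp.2 ?_
  have h1 : -(c * s) ≤ |c| * |s| := by rw [← abs_mul]; exact neg_le_abs _
  have h2 : 0 ≤ b * (|s| - (M + |c|) / (2 * b)) ^ 2 := by positivity
  have h3 : b * (|s| - (M + |c|) / (2 * b)) ^ 2 = b * |s| ^ 2 - (M + |c|) * |s| + (M + |c|) ^ 2 / (4 * b) := by
    field_simp; ring
  have h4 : |s| ^ 2 = s ^ 2 := sq_abs s
  nlinarith

/-- **Gaussian-windowed functions with temperate derivatives decay super-exponentially**, with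
constants linear in the temperate bound `A`: if `‖DᵐG(s)‖ ≤ A (1+|s|)ᴺ` for `m ≤ j`, then
`‖Dʲ(e^{-bs²}G)(s)‖ ≤ A (1 + 2|b|(1+j))ʲ e^{((N+j)+|c|)²/(4b)} e^{cs}`. [folklore] -/
theorem norm_iteratedDeriv_gaussian_mul_le {b : ℝ} (hb : 0 < b) {G : ℝ → ℂ} (hG : ContDiff ℝ (⊤ : ℕ∞) G) (j : ℕ)
    {A : ℝ} {N : ℕ} (hA : ∀ m ≤ j, ∀ s, ‖iteratedDeriv m G s‖ ≤ A * (1 + |s|) ^ N) (c s : ℝ) :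
    ‖iteratedDeriv j (fun s : ℝ => Complex.exp (-(b : ℂ) * (s : ℂ) ^ 2) * G s) s‖ ≤
      A * (1 + 2 * |b| * (1 + j)) ^ j * Real.exp ((((N + j : ℕ) : ℝ) + |c|) ^ 2 / (4 * b)) * Real.exp (c * s) := by
  rw [iteratedDeriv_gaussian_mul b hG j]
  have hA0 : 0 ≤ A := by
    have h := hA 0 (Nat.zero_le _) 0
    simp only [iteratedDeriv_zero, abs_zero, add_zero, one_pow, mul_one] at h
    exact (norm_nonneg _).trans h
  have h1 := norm_iteratedDeriv_gaussSeq_le b hG j hA j 0 (by omega) s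
  rw [iteratedDeriv_zero] at h1
  simp only [norm_mul, Complex.norm_exp]
  have hre : (-(b : ℂ) * (s : ℂ) ^ 2).re = -b * s ^ 2 := by
    have : (-(b : ℂ) * (s : ℂ) ^ 2) = ((-b * s ^ 2 : ℝ) : ℂ) := by push_cast; ring
    rw [this, Complex.ofReal_re]
  rw [hre]
  have hpow : (1 + |s|) ^ (N + j) ≤ Real.exp (((N + j : ℕ) : ℝ) * |s|) := by
    calc (1 + |s|) ^ (N + j) ≤ (Real.exp |s|) ^ (N + j) :=
          pow_le_pow_left₀ (by positivity) (by have := Real.add_one_le_exp |s|; linarith) _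
      _ = Real.exp (((N + j : ℕ) : ℝ) * |s|) := by rw [← Real.exp_nat_mul]
  have hg := exp_gauss_bound hb (((N + j : ℕ) : ℝ)) c s
  calc Real.exp (-b * s ^ 2) * ‖gaussSeq b G j s‖
      ≤ Real.exp (-b * s ^ 2) * (A * (1 + 2 * |b| * (1 + j)) ^ j * (1 + |s|) ^ (N + j)) :=
        mul_le_mul_of_nonneg_left h1 (Real.exp_pos _).le
    _ ≤ Real.exp (-b * s ^ 2) * (A * (1 + 2 * |b| * (1 + j)) ^ j * Real.exp (((N + j : ℕ) : ℝ) * |s|)) := by gcongr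
    _ = A * (1 + 2 * |b| * (1 + j)) ^ j * (Real.exp (-b * s ^ 2) * Real.exp (((N + j : ℕ) : ℝ) * |s|)) := by ring
    _ ≤ A * (1 + 2 * |b| * (1 + j)) ^ j * (Real.exp ((((N + j : ℕ) : ℝ) + |c|) ^ 2 / (4 * b)) * Real.exp (c * s)) := by
        gcongr
    _ = A * (1 + 2 * |b| * (1 + j)) ^ j * Real.exp ((((N + j : ℕ) : ℝ) + |c|) ^ 2 / (4 * b)) * Real.exp (c * s) :=
        (mul_assoc _ _ _).symm

/-- **Super-exponential decay of Gaussian-windowed temperate functions**: if `G` is smooth with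
every derivative of temperate growth, then `s ↦ e^{-bs²} G(s)` (`b > 0`) has `SuperExpDecay`. [folklore] -/
theorem superExpDecay_gaussian_mul {b : ℝ} (hb : 0 < b) {G : ℝ → ℂ} (hG : ContDiff ℝ (⊤ : ℕ∞) G)
    (htemp : ∀ m : ℕ, ∃ (A : ℝ) (N : ℕ), ∀ s, ‖iteratedDeriv m G s‖ ≤ A * (1 + |s|) ^ N) :
    SuperExpDecay fun s : ℝ => Complex.exp (-(b : ℂ) * (s : ℂ) ^ 2) * G s := by
  intro j c
  -- a common bound for the derivatives of order `≤ j`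
  choose A N hAN using htemp
  set A' : ℝ := (Finset.range (j + 1)).sum fun m => |A m| with hA'
  set N' : ℕ := (Finset.range (j + 1)).sup N with hN'
  have hcommon : ∀ m ≤ j, ∀ s, ‖iteratedDeriv m G s‖ ≤ A' * (1 + |s|) ^ N' := by
    intro m hm s
    have hmr : m ∈ Finset.range (j + 1) := Finset.mem_range.2 (by omega)
    refine (hAN m s).trans ?_
    have h1 : A m ≤ A' := (le_abs_self _).trans (Finset.single_le_sum (f := fun m => |A m|) (fun _ _ => abs_nonneg _) hmr)
    have h2 : (1 + |s|) ^ N m ≤ (1 + |s|) ^ N' :=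
      pow_le_pow_right₀ (by linarith [abs_nonneg s]) (Finset.le_sup (f := N) hmr)
    have hA'0 : 0 ≤ A' := Finset.sum_nonneg fun _ _ => abs_nonneg _
    calc A m * (1 + |s|) ^ N m ≤ A' * (1 + |s|) ^ N m := by
          refine mul_le_mul_of_nonneg_right h1 (by positivity)
      _ ≤ A' * (1 + |s|) ^ N' := mul_le_mul_of_nonneg_left h2 hA'0
  exact ⟨_, fun s => norm_iteratedDeriv_gaussian_mul_le hb hG j hcommon c s⟩

/-- The Gaussian-windowed function is smooth. [folklore] -/
theorem contDiff_gaussian_mul (b : ℝ) {G : ℝ → ℂ} (hG : ContDiff ℝ (⊤ : ℕ∞) G) :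
    ContDiff ℝ (⊤ : ℕ∞) fun s : ℝ => Complex.exp (-(b : ℂ) * (s : ℂ) ^ 2) * G s :=
  (Complex.contDiff_exp.comp (contDiff_const.mul (Complex.ofRealCLM.contDiff.pow 2))).mul hG

/-! ### Instances: Schwartz profiles and modulations -/

/-- Schwartz functions have temperate (indeed bounded) derivatives. [folklore] -/
theorem temperate_of_schwartz (ϑ : SchwartzMap ℝ ℂ) (m : ℕ) :
    ∃ (A : ℝ) (N : ℕ), ∀ s, ‖iteratedDeriv m ϑ s‖ ≤ A * (1 + |s|) ^ N :=
  ⟨SchwartzMap.seminorm ℝ 0 m ϑ, 0, fun s => by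
    rw [pow_zero, mul_one, ← norm_iteratedFDeriv_eq_norm_iteratedDeriv]
    exact ϑ.norm_iteratedFDeriv_le_seminorm ℝ m s⟩

/-- The iterated derivatives of a modulation `s ↦ e^{cs}` (`c ∈ ℂ`, real variable). [folklore] -/
theorem iteratedDeriv_cexp_mul_ofReal (c : ℂ) (n : ℕ) :
    iteratedDeriv n (fun s : ℝ => Complex.exp (c * (s : ℂ))) = fun s : ℝ => c ^ n * Complex.exp (c * (s : ℂ)) := by
  induction n with
  | zero => funext s; simp
  | succ n ih =>
      rw [iteratedDeriv_succ, ih]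
      funext s
      have h1 : HasDerivAt (fun s : ℝ => c * (s : ℂ)) (c * 1) s := (Complex.ofRealCLM.hasDerivAt (x := s)).const_mul c
      have h2 := (h1.cexp).const_mul (c ^ n)
      simp only [mul_one] at h2
      rw [h2.deriv]
      ring

/-- Modulations have temperate derivatives, with constants polynomial in the frequency:
`‖Dᵐ e^{-2πips}‖ = (2π|p|)ᵐ ≤ (1 + 2π|p|)ʲ` for `m ≤ j`. [folklore] -/
theorem norm_iteratedDeriv_modulation_le (p : ℝ) {m j : ℕ} (hm : m ≤ j) (s : ℝ) :
    ‖iteratedDeriv m (fun s : ℝ => Complex.exp (↑(-2 * Real.pi * s * p) * Complex.I)) s‖ ≤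
      (1 + 2 * Real.pi * |p|) ^ j * (1 + |s|) ^ 0 := by
  have hfun : (fun s : ℝ => Complex.exp (↑(-2 * Real.pi * s * p) * Complex.I)) =
      fun s : ℝ => Complex.exp ((↑(-2 * Real.pi * p) * Complex.I) * (s : ℂ)) := by
    funext s; congr 1; push_cast; ring
  rw [hfun, iteratedDeriv_cexp_mul_ofReal, pow_zero, mul_one, norm_mul, norm_pow]
  have hn : ‖(↑(-2 * Real.pi * p) * Complex.I : ℂ)‖ = 2 * Real.pi * |p| := by
    rw [norm_mul, Complex.norm_I, mul_one, Complex.norm_real, Real.norm_eq_abs, abs_mul, abs_mul, abs_neg,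
      abs_two, abs_of_pos Real.pi_pos]
  have hexp : ‖Complex.exp ((↑(-2 * Real.pi * p) * Complex.I) * (s : ℂ))‖ = 1 := by
    rw [show (↑(-2 * Real.pi * p) * Complex.I) * (s : ℂ) = ↑(-2 * Real.pi * p * s) * Complex.I by push_cast; ring,
      Complex.norm_exp_ofReal_mul_I]
  rw [hn, hexp, mul_one]
  calc (2 * Real.pi * |p|) ^ m ≤ (1 + 2 * Real.pi * |p|) ^ m :=
        pow_le_pow_left₀ (by positivity) (by linarith) m
    _ ≤ (1 + 2 * Real.pi * |p|) ^ j := pow_le_pow_right₀ (by linarith [mul_nonneg (mul_nonneg zero_le_two Real.pi_pos.le) (abs_nonneg p)]) hm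

end Literature.Analysis.Distribution
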